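import Summits.BirchSwinnertonDyer.BirchSwinnertonDyer.Theorems.PrintCf2SplitBadTwoStrictDefectClassThreeSocket
import Summits.BirchSwinnertonDyer.BirchSwinnertonDyer.Theorems.PrintCf2SplitBadTwoLineDecompVbarTrivialEvenSeven
import Summits.BirchSwinnertonDyer.BirchSwinnertonDyer.Theorems.PrintCf2SplitBadTwoCMPrimaryDyadicValueFrame
import Summits.BirchSwinnertonDyer.BirchSwinnertonDyer.Theorems.PrintCf2SplitBadTwoLocalControlKernelDyadicCM
import Literature.NumberTheory.GaloisRepresentations.AbsGaloisGroupCompact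
import HarnessLib

/-!
# Crux `PrintCf2.SplitBadTwoRankOneOfFacts` (stmt-BirchSwinnertonDyer-20368), skeleton v13.1, stub S3d `stub_strictDefectAtVbar_two`
# (= route-C item 24036 `StrictDefectAtVbarTwo`) — the class-(iii) RECEPTACLE IS `W*` ITSELF: the three `W*`-side inputs
# `hH`, `hinv`, `hcoinvH` of the spine's part IV

Cell `bsd-print-cf2`, EXTRA WIDTH seat `bsd-line-cf2-p1-w3` g12 (prover-bsd-line-cf2-p1-w3-g12-0); `--supports stmt-BirchSwinnertonDyer-20368`
(helper, Theses-free). HONEST FRAMING: nothing here closes the crux or the registered stub S3d; BSD is not proved by any of this; no summit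
statement is proved by this seat. No definition, no named fact, no `sorry`. Sequel of -w3 g11's spine parts III–IV
(`…StrictDefectDichotomy`, `…StrictDefectClassThreeSocket`), of -w6 g4/g5's `D″`-triviality (`…LineDecompVbarTrivial[EvenSeven]`) and of the
B15 dyadic tables (`…CMPrimaryDyadicTableStrict`, `…CMPrimaryDyadicValueFrame`, `…LocalControlKernelDyadicCM`).

WHY. Part IV `StrictDefect.valuation_eq_add_of_natCard_endCoinvariants_eq_one_endEigenPrimaryTorsion` reads `ord₂ H'(0) = n + a` on class (iii)
(`d ≡ 3 (8)` or `d ≡ 14 (16)`) from: an abelian group `H` with an endomorphism `ψ_H` such that every infinite subgroup of `H` is `⊤` (`hH`),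
`#H^{ψ_H} = 2 ^ a` (`hinv`), `H_{ψ_H} = 0` (`hcoinvH`), and an equivariant INJECTION `j : Q ↪ H` of the defect quotient
`Q = S_{W*}(K'_∞) ⧸ 𝔖_{v̄}(K'_∞, W*)`. Surjectivity of `j` is never asked (part III `bijective_of_injective_of_not_finite` gets it from «`Q` infinite»,
-w7 g5 p693491). So the receptacle may be taken to be `W* = E[𝔮_r^∞]` ITSELF with `ψ_H := (δ • ·) − 1` for a `δ ∈ D_v̄` lifting the line's
generator (`κ' δ = κ' γ'`), and then the three inputs are statements about the `Γ_K`-module `W*` alone — this file proves them: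
* §1 (generic, any field `K`, any `ℤ_p`-line `κ`, any `Γ_K`-set `M`, any COMPACT subgroup `D ≤ Γ_K`): **`smul_eq_self_of_mem_of_isTopGenerator`** —
  if `D ∩ ker κ` fixes `x`, the stabiliser of `x` is closed, and `δ ∈ D` with `κ δ = 1` fixes `x`, then ALL of `D` fixes `x`
  (`κ(Stab(x) ∩ D)` is a closed subset of `ℤ_p` containing `κ(δ^ℕ) = ℕ`, dense; so it is `ℤ_p ⊇ κ(D)`, and `D = (Stab(x) ∩ D)·(D ∩ ker κ)`);
  hence **`endInvariants_smul_sub_one_eq_fixedPoints`**: `ker((δ•) − 1) = M^{D}` as subgroups.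
* §2 (the CM summand `C = E[𝔮_ρ^∞]` of a `j = −3375` curve over `L ∋ √−7`, B15 currency): **`eq_top_of_not_finite_endEigenPrimaryTorsion`** (`hH`:
  every infinite subgroup of `↥C` is `⊤` — B15 `eq_of_le_of_infinite` transported to subgroups of the subtype) and
  **`subsingleton_endCoinvariants_smul_sub_one_of_smul_ne`** (`hcoinvH`: if `δ` moves a point of `C` then `C ⧸ (δ − 1)C = 0` — B15
  `exists_smul_sub_eq_of_smul_ne`).
* §3 (road-α frames, class (iii): member `C • W = cm7^{(d)}`, `K` imaginary quadratic, `2 = v v̄`, `W*` pinned at `v`, line `κ'` unramified outside `v̄`,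
  `δ ∈ D_v̄` with `κ' δ = 1`): **`smul_eq_self_of_mem_decomp_vbar_of_isTopGenerator_of_frame_classThree`** (§1 with -w6 g5's
  `smul_eq_self_of_mem_decomp_vbar_inf_kerSubgroup_of_frame_classThree`), **`natCard_endInvariants_smul_sub_one_eq_four_of_frame_three`** /
  **`…_eq_two_of_frame_even_seven`** (`hinv`: `#W*^{δ} = #W*^{D_v̄} = 4`, resp. `2`, B15), **`subsingleton_endCoinvariants_smul_sub_one_of_frame_classThree`**
  (`hcoinvH`), `eq_top_of_not_finite_endEigenPrimaryTorsion_of_frame` (`hH`).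
* Sequel file `…StrictDefectClassThreeReader` re-instantiates part IV with `H := W*` (`valuation_eq_add_two_of_frame_three`,
  `valuation_eq_add_one_of_frame_even_seven`): the only displayed inputs left there are the spine data, an equivariant injection `j : Q →+ W*`,
  `(S_nr)_Γ = 0` (-w4 g11) and `𝔖 ≠ S_nr` (-w7 g5); conclusion `ord₂ H'(0) = n + 2` on `d ≡ 3 (8)`, `n + 1` on `d ≡ 14 (16)` (scrit R113).
The surjectivity transport (T2) (`Def ≅ W*` via `IsFreeProcyclic`) is NOT used here; it is still used once elsewhere (-w4 g11's `h𝓛`).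

presearch: Greenberg–Vatsal 2000 §2 (Cor. 2.3: comparison of Selmer groups for two local conditions differing at one prime, the local term
`𝓗_v = H¹_nr/H¹_str ≅ W*` up to finite index); Greenberg LNM 1716 §3 Lemma 3.1 / p. 87 (`(γ − 1)B = B` for `B` divisible with non-trivial scalar
action); Washington §13.1 (topological generators of `ℤ_p`-extensions) — held; tree assembly, no new fact. beyond-print theorem: no.

References: [GreenbergVatsal2000] §2 Prop. 2.1, Cor. 2.3, Prop. 2.4 (pp. 17–22); [GreenbergLNM1716] §3 Lemma 3.1, p. 87, §4 Lemma 4.2;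
[Rubin1999] §2, §3 Cor. 3.17, Prop. 5.4; [Washington1997] §13.1; [NeukirchANT1999] Ch. II §9 (9.6), Ch. IV (1.1); [Agboola2007] §3 Prop. 3.2, §6, Prop. 8.1.
-/

noncomputable section

open scoped Classical

-- the summit namespace `Summit.BirchSwinnertonDyer.BirchSwinnertonDyer` repeats the problem name by design (D-0017)
set_option linter.dupNamespace false
set_option autoImplicit false

open NumberField IsDedekindDomain Field
open Literature.NumberTheory.EllipticCurves Literature.NumberTheory.EllipticCurves.GreenbergSelmer
open Literature.NumberTheory.EllipticCurves.GreenbergVatsal2000 Literature.NumberTheory.EllipticCurves.KellerYin2024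
open Literature.NumberTheory.EllipticCurves.Agboola2007
open Literature.NumberTheory.EllipticCurves.IwasawaAlgebra Literature.NumberTheory.EllipticCurves.IwasawaDual
open Literature.NumberTheory.GaloisRepresentations

universe u

namespace Summit.BirchSwinnertonDyer.BirchSwinnertonDyer.Theorems.PrintCf2.StrictDefect

/-! ## §1. Topological generation inside a compact subgroup: `M^{δ} = M^{D}` -/

section TopGen

variable {K : Type u} [Field K] {p : ℕ} [Fact p.Prime] (κ : ZpExtension K p)
  {M : Type*} [MulAction (absoluteGaloisGroup K) M]

/-- **`D ∩ ker κ` and ONE `δ ∈ D` with `κ δ = 1` fix whatever they both fix, for ALL of `D`.** `K` any field, `κ : Γ_K ↠ ℤ_p` a `ℤ_p`-extension,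
`D ≤ Γ_K` a subgroup with COMPACT carrier (e.g. a decomposition group), `x` a point of a `Γ_K`-set with closed stabiliser. If every element of
`D ∩ ker κ` fixes `x` and `δ ∈ D` with `κ δ = 1` fixes `x`, then every `g ∈ D` fixes `x`: `T := Stab(x) ∩ D` is compact, so `κ(T) ⊆ ℤ_p` is closed;
it contains `κ(δ^n) = n` for every `n : ℕ`, a dense set, hence `κ(T) = ℤ_p`; so `κ g = κ s` for some `s ∈ T`, and `g = (g s⁻¹) s` with
`g s⁻¹ ∈ D ∩ ker κ`. (Washington: the image of a topological generator generates `Gal(K_∞/K) ≅ ℤ_p` topologically.) [cite: Washington1997, §13.1] -/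
theorem smul_eq_self_of_mem_of_isTopGenerator (D : Subgroup (absoluteGaloisGroup K))
    (hD : IsCompact (D : Set (absoluteGaloisGroup K))) {x : M}
    (hx : IsClosed (MulAction.stabilizer (absoluteGaloisGroup K) x : Set (absoluteGaloisGroup K)))
    (htriv : ∀ g ∈ D, κ g = 1 → g • x = x)
    {δ : absoluteGaloisGroup K} (hδD : δ ∈ D) (hδ : κ.IsTopGenerator δ) (hδx : δ • x = x)
    {g : absoluteGaloisGroup K} (hg : g ∈ D) : g • x = x := by
  set S := MulAction.stabilizer (absoluteGaloisGroup K) x with hS_def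
  set T : Set (absoluteGaloisGroup K) := (S : Set (absoluteGaloisGroup K)) ∩ (D : Set (absoluteGaloisGroup K))
    with hT_def
  have hTc : IsCompact T := hD.inter_left hx
  let f : absoluteGaloisGroup K → ℤ_[p] := fun g ↦ (κ g).toAdd
  have hf : Continuous f := continuous_toAdd.comp (map_continuous κ)
  have himg : IsClosed (f '' T) := (hTc.image hf).isClosed
  have hδ1 : (κ δ).toAdd = 1 := by
    rw [show κ δ = Multiplicative.ofAdd 1 from hδ, toAdd_ofAdd]
  have hnat : Set.range (Nat.cast : ℕ → ℤ_[p]) ⊆ f '' T := by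
    rintro _ ⟨n, rfl⟩
    refine ⟨δ ^ n, ⟨S.pow_mem (MulAction.mem_stabilizer_iff.mpr hδx) n, D.pow_mem hδD n⟩, ?_⟩
    show (κ (δ ^ n)).toAdd = (n : ℤ_[p])
    rw [map_pow, toAdd_pow, hδ1, nsmul_eq_mul, mul_one]
  have huniv : f '' T = Set.univ := by
    apply Set.eq_univ_of_univ_subset
    rw [← (PadicInt.denseRange_natCast (p := p)).closure_range, ← himg.closure_eq]
    exact closure_mono hnat
  obtain ⟨s, ⟨hsS, hsD⟩, hsg⟩ := (Set.eq_univ_iff_forall.mp huniv) (f g)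
  have hκ : κ s = κ g := Multiplicative.toAdd.injective hsg
  have hk : κ (g * s⁻¹) = 1 := by rw [map_mul, map_inv, ← hκ, mul_inv_cancel]
  have hkx : (g * s⁻¹) • x = x := htriv _ (D.mul_mem hg (D.inv_mem hsD)) hk
  have hsx : s • x = x := MulAction.mem_stabilizer_iff.mp hsS
  calc g • x = (g * s⁻¹ * s) • x := by rw [inv_mul_cancel_right]
    _ = (g * s⁻¹) • (s • x) := mul_smul _ _ _
    _ = x := by rw [hsx, hkx]

end TopGen

section Invariants

variable {K : Type u} [Field K] {p : ℕ} [Fact p.Prime] (κ : ZpExtension K p)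
  {M : Type*} [AddCommGroup M] [DistribMulAction (absoluteGaloisGroup K) M]

/-- Unfolding: the endomorphism `(δ •) − 1` of a `Γ_K`-module sends `x` to `δ • x − x`. [folklore] -/
theorem smulEnd_sub_one_apply (δ : absoluteGaloisGroup K) (x : M) :
    (DistribMulAction.toAddMonoidEnd (absoluteGaloisGroup K) M δ - 1) x = δ • x - x :=
  rfl

/-- `x ∈ ker((δ •) − 1) ↔ δ • x = x` (the `ψ`-invariants of `ψ = δ − 1` are the fixed points of `δ`). [folklore] -/
theorem mem_endInvariants_smul_sub_one_iff (δ : absoluteGaloisGroup K) (x : M) :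
    x ∈ endInvariants (DistribMulAction.toAddMonoidEnd (absoluteGaloisGroup K) M δ - 1) ↔ δ • x = x := by
  rw [mem_endInvariants_iff, smulEnd_sub_one_apply, sub_eq_zero]

/-- **`M^{δ} = M^{D}` as subgroups**: for a `Γ_K`-module `M` with open stabilisers, a subgroup `D ≤ Γ_K` with compact carrier on which
`D ∩ ker κ` acts trivially on `M`, and `δ ∈ D` with `κ δ = 1`, the invariants of the endomorphism `(δ •) − 1` are exactly the `D`-fixed points
(`smul_eq_self_of_mem_of_isTopGenerator` pointwise). This is the bridge from the spine's `endInvariants ψ_H` (part IV's `hinv`) to the B15 counts of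
`FixedPoints.addSubgroup (decomp v̄) W*`. [cite: Washington1997, §13.1] -/
theorem endInvariants_smul_sub_one_eq_fixedPoints (D : Subgroup (absoluteGaloisGroup K))
    (hD : IsCompact (D : Set (absoluteGaloisGroup K)))
    (hstab : ∀ x : M, IsOpen (MulAction.stabilizer (absoluteGaloisGroup K) x : Set (absoluteGaloisGroup K)))
    (htriv : ∀ g ∈ D, κ g = 1 → ∀ x : M, g • x = x)
    {δ : absoluteGaloisGroup K} (hδD : δ ∈ D) (hδ : κ.IsTopGenerator δ) :
    endInvariants (DistribMulAction.toAddMonoidEnd (absoluteGaloisGroup K) M δ - 1) = FixedPoints.addSubgroup ↥D M := by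
  ext x
  rw [mem_endInvariants_smul_sub_one_iff, FixedPoints.mem_addSubgroup]
  constructor
  · intro hx g
    rw [Subgroup.smul_def]
    exact smul_eq_self_of_mem_of_isTopGenerator κ D hD ((MulAction.stabilizer _ x).isClosed_of_isOpen (hstab x))
      (fun g hg hg1 ↦ htriv g hg hg1 x) hδD hδ hx g.2
  · intro hx
    exact hx ⟨δ, hδD⟩

end Invariants

/-! ## §2. The CM summand `C = E[𝔮_ρ^∞]` as receptacle: cocyclic (`hH`) and `δ − 1` onto (`hcoinvH`) -/

section Summand

open WeierstrassCurve

variable (W : WeierstrassCurve ℚ) [W.IsElliptic] (L : Type) [Field L] [NumberField L]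

/-- **`hH` for `H := W*`: every INFINITE subgroup of `↥C`, `C = E[𝔮_ρ^∞]` (`j = −3375`, `L ∋ θ` with `θ² = −7`, `π² = π − 2`, `ρ² = ρ − 2`), is `⊤`**
— B15's `CMPrimes.eq_of_le_of_infinite` (`C ≅ ℚ₂/ℤ₂` is cocyclic) transported along `C.subtype` to subgroups of the subtype, the shape of the
hypothesis `hH` of the spine's parts III–IV. [cite: Rubin1999, §2 and Prop. 5.4] -/
theorem eq_top_of_not_finite_endEigenPrimaryTorsion (hj : W.j = -3375) {θ : L} (hθ : θ ^ 2 = -7)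
    (π : (W.baseChange L).endRing) (hrel : (π : AddMonoid.End (W.baseChange L).geomPoints) * π = π - 2)
    {ρ : ℤ_[2]} (hρ : ρ * ρ = ρ - 2) (A : AddSubgroup ↥((W.baseChange L).endEigenPrimaryTorsion 2 π ρ)) (hA : ¬ Finite A) :
    A = ⊤ := by
  have hle : A.map ((W.baseChange L).endEigenPrimaryTorsion 2 π ρ).subtype ≤ (W.baseChange L).endEigenPrimaryTorsion 2 π ρ := by
    rintro _ ⟨y, -, rfl⟩; exact y.2
  have hinf : ¬ Finite ↥(A.map ((W.baseChange L).endEigenPrimaryTorsion 2 π ρ).subtype) := by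
    intro h
    exact hA (Finite.of_equiv _
      (AddSubgroup.equivMapOfInjective A ((W.baseChange L).endEigenPrimaryTorsion 2 π ρ).subtype Subtype.val_injective).toEquiv.symm)
  have heq := CMPrimes.eq_of_le_of_infinite W L hj hθ π hrel hρ hle hinf
  rw [eq_top_iff]
  intro x _
  have hx : (x : (W.baseChange L).geomPrimaryTorsion 2) ∈ A.map ((W.baseChange L).endEigenPrimaryTorsion 2 π ρ).subtype := by
    rw [heq]; exact x.2
  obtain ⟨y, hy, hyx⟩ := hx
  have hyx' : y = x := Subtype.ext hyx
  exact hyx' ▸ hy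

/-- **`hcoinvH` for `H := W*`: if `δ ∈ Γ_L` MOVES some point of `C = E[𝔮_ρ^∞]`, the coinvariants `C ⧸ (δ − 1)C` are trivial** — B15's
`CMPrimes.exists_smul_sub_eq_of_smul_ne` (`δ − 1` has finite kernel on the cocyclic `C`, so its image is infinite, hence everything; Greenberg:
"`(γ − 1)B = B`") read as `Subsingleton (EndCoinvariants ((δ •) − 1))`. [cite: GreenbergLNM1716, §3 Lemma 3.1 and p. 87] [cite: Rubin1999, §2 and Prop. 5.4] -/
theorem subsingleton_endCoinvariants_smul_sub_one_of_smul_ne (hj : W.j = -3375) {θ : L} (hθ : θ ^ 2 = -7)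
    (π : (W.baseChange L).endRing) (hrel : (π : AddMonoid.End (W.baseChange L).geomPoints) * π = π - 2)
    {ρ : ℤ_[2]} (hρ : ρ * ρ = ρ - 2) {δ : absoluteGaloisGroup L}
    (hδ : ∃ x : ↥((W.baseChange L).endEigenPrimaryTorsion 2 π ρ), δ • x ≠ x) :
    Subsingleton (EndCoinvariants
      (DistribMulAction.toAddMonoidEnd (absoluteGaloisGroup L) ↥((W.baseChange L).endEigenPrimaryTorsion 2 π ρ) δ - 1)) := by
  obtain ⟨x, hx⟩ := hδ
  have hσ : ∃ y ∈ (W.baseChange L).endEigenPrimaryTorsion 2 π ρ, δ • y ≠ y :=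
    ⟨x, x.2, fun h ↦ hx (Subtype.ext (by rw [endEigenPrimaryTorsion.coe_smul]; exact h))⟩
  have honto := CMPrimes.exists_smul_sub_eq_of_smul_ne W L hj hθ π hrel hρ δ hσ
  rw [QuotientAddGroup.subsingleton_iff, eq_top_iff]
  intro z _
  obtain ⟨y, hy, hyz⟩ := honto z z.2
  refine ⟨⟨y, hy⟩, Subtype.ext ?_⟩
  rw [AddMonoidHom.coe_coe, smulEnd_sub_one_apply, AddSubgroupClass.coe_sub, endEigenPrimaryTorsion.coe_smul]
  exact hyz

end Summand

/-! ## §3. Road-α frames, class (iii): `W*^{δ} = W*^{D_v̄}` has `4` resp. `2` elements, `W*_{δ} = 0`, `W*` cocyclic -/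

section Frame

open WeierstrassCurve
open Summit.BirchSwinnertonDyer.BirchSwinnertonDyer.Theorems.PrintCf2.AdditiveAtSeven
open Summit.BirchSwinnertonDyer.BirchSwinnertonDyer.Theorems.PrintCf2.RestrictedSelmerPair

variable {K : Type} [Field K] [NumberField K]

/-- `D_v` has compact carrier (continuous image of the compact `Γ_{K_v}`; the tree's `Kobayashi2003.isCompact_decomp`, re-proved to keep imports light).
[cite: NeukirchANT1999, Ch. IV (1.1) and Ch. II §9 Prop. (9.6)] -/
theorem isCompact_decomp (v : HeightOneSpectrum (𝓞 K)) :
    IsCompact (GreenbergSelmer.decomp (K := K) v : Set (absoluteGaloisGroup K)) := by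
  haveI : CompactSpace (absoluteGaloisGroup (v.adicCompletion K)) := absoluteGaloisGroup_compactSpace _
  exact isCompact_range (map_continuous (absGaloisRestrict K (v.adicCompletion K)))

/-- **On class (iii) (`d ≡ 3 (8)` or `d ≡ 14 (16)`) a point of `W*` fixed by ONE `δ ∈ D_v̄` with `κ' δ = 1` is fixed by ALL of `D_v̄`.**
Frame: member `C • W = cm7^{(d)}`, `K` imaginary quadratic, `2 = v v̄`, `π² = π − 2`, `r² = r − 2`, pinning clause at `v` for `W* = E[𝔮_r^∞]`, `κ'`
unramified outside `v̄`. §1 with `D := D_v̄` (compact), `D_v̄ ∩ ker κ'` acting trivially (-w6 g4/g5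
`smul_eq_self_of_mem_decomp_vbar_inf_kerSubgroup_of_frame_classThree`) and open stabilisers. [cite: Washington1997, §13.1] [cite: Rubin1999, §3 Cor. 3.17] -/
theorem smul_eq_self_of_mem_decomp_vbar_of_isTopGenerator_of_frame_classThree {d : ℤ} (hd0 : d ≠ 0)
    (hcl : d % 8 = 3 ∨ ((2 : ℤ) ∣ d ∧ (d / 2) % 8 = 7))
    (W : WeierstrassCurve ℚ) [W.IsElliptic] (C : VariableChange ℚ) (hC : C • W = cm7.quadraticTwist (d : ℚ)) (hK : IsImaginaryQuadratic K)
    (v vbar : HeightOneSpectrum (𝓞 K)) (hv : ((2 : ℕ) : 𝓞 K) ∈ v.asIdeal) (hvbar : ((2 : ℕ) : 𝓞 K) ∈ vbar.asIdeal) (hne : vbar ≠ v)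
    (π : (W.baseChange K).endRing) (hrel : (π : AddMonoid.End (W.baseChange K).geomPoints) * π = π - 2) {r : ℤ_[2]} (hr : r * r = r - 2)
    (hpin : ∀ τ ∈ GreenbergSelmer.inertia v, ∀ x : ↥((W.baseChange K).endEigenPrimaryTorsion 2 π r), τ • x = x ∨ τ • x = -x)
    (κ' : ZpExtension K 2) (hκ' : κ'.IsUnramifiedOutside vbar)
    {δ : absoluteGaloisGroup K} (hδD : δ ∈ GreenbergSelmer.decomp vbar) (hδ : κ'.IsTopGenerator δ)
    {x : ↥((W.baseChange K).endEigenPrimaryTorsion 2 π r)} (hδx : δ • x = x)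
    {g : absoluteGaloisGroup K} (hg : g ∈ GreenbergSelmer.decomp vbar) : g • x = x :=
  smul_eq_self_of_mem_of_isTopGenerator κ' (GreenbergSelmer.decomp vbar) (isCompact_decomp vbar)
    ((MulAction.stabilizer _ x).isClosed_of_isOpen (isOpen_stabilizer_endEigenPrimaryTorsion (W.baseChange K) 2 π r x))
    (fun _ hg hg1 ↦ smul_eq_self_of_mem_decomp_vbar_inf_kerSubgroup_of_frame_classThree hd0 hcl W C hC hK v vbar hv hvbar hne π
      hrel hr hpin κ' hκ' hg (ZpExtension.mem_kerSubgroup.mpr hg1) x) hδD hδ hδx hg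

/-- **`W*^{δ} = W*^{D_v̄}` on class (iii)**: the invariants of `(δ •) − 1` (`δ ∈ D_v̄`, `κ' δ = 1`) are the `D_v̄`-fixed points of `W*` — the subgroup
counted by the B15 tables. [cite: Washington1997, §13.1] [cite: Rubin1999, §3 Cor. 3.17] -/
theorem endInvariants_smul_sub_one_eq_fixedPoints_decomp_vbar_of_frame_classThree {d : ℤ} (hd0 : d ≠ 0)
    (hcl : d % 8 = 3 ∨ ((2 : ℤ) ∣ d ∧ (d / 2) % 8 = 7))
    (W : WeierstrassCurve ℚ) [W.IsElliptic] (C : VariableChange ℚ) (hC : C • W = cm7.quadraticTwist (d : ℚ)) (hK : IsImaginaryQuadratic K)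
    (v vbar : HeightOneSpectrum (𝓞 K)) (hv : ((2 : ℕ) : 𝓞 K) ∈ v.asIdeal) (hvbar : ((2 : ℕ) : 𝓞 K) ∈ vbar.asIdeal) (hne : vbar ≠ v)
    (π : (W.baseChange K).endRing) (hrel : (π : AddMonoid.End (W.baseChange K).geomPoints) * π = π - 2) {r : ℤ_[2]} (hr : r * r = r - 2)
    (hpin : ∀ τ ∈ GreenbergSelmer.inertia v, ∀ x : ↥((W.baseChange K).endEigenPrimaryTorsion 2 π r), τ • x = x ∨ τ • x = -x)
    (κ' : ZpExtension K 2) (hκ' : κ'.IsUnramifiedOutside vbar)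
    {δ : absoluteGaloisGroup K} (hδD : δ ∈ GreenbergSelmer.decomp vbar) (hδ : κ'.IsTopGenerator δ) :
    endInvariants (DistribMulAction.toAddMonoidEnd (absoluteGaloisGroup K) ↥((W.baseChange K).endEigenPrimaryTorsion 2 π r) δ - 1) =
      FixedPoints.addSubgroup ↥(GreenbergSelmer.decomp vbar) ↥((W.baseChange K).endEigenPrimaryTorsion 2 π r) :=
  endInvariants_smul_sub_one_eq_fixedPoints κ' (GreenbergSelmer.decomp vbar) (isCompact_decomp vbar)
    (isOpen_stabilizer_endEigenPrimaryTorsion (W.baseChange K) 2 π r)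
    (fun _ hg hg1 x ↦ smul_eq_self_of_mem_decomp_vbar_inf_kerSubgroup_of_frame_classThree hd0 hcl W C hC hK v vbar hv hvbar hne π
      hrel hr hpin κ' hκ' hg (ZpExtension.mem_kerSubgroup.mpr hg1) x) hδD hδ

/-- **`hinv` on `d ≡ 3 (mod 8)`: `#W*^{δ} = 4 = 2 ^ 2`** (`δ ∈ D_v̄`, `κ' δ = 1`) — `W*^{δ} = W*^{D_v̄}` and B15's exact dyadic value
`CMPrimes.natCard_fixedPoints_decomp_vbar_eq_four_of_frame`. [cite: Agboola2007, §6 and Prop. 8.1] [cite: Rubin1999, §3 Cor. 3.17] -/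
theorem natCard_endInvariants_smul_sub_one_eq_four_of_frame_three {d : ℤ} (hd0 : d ≠ 0) (hd8 : d % 8 = 3)
    (W : WeierstrassCurve ℚ) [W.IsElliptic] (C : VariableChange ℚ) (hC : C • W = cm7.quadraticTwist (d : ℚ)) (hK : IsImaginaryQuadratic K)
    (v vbar : HeightOneSpectrum (𝓞 K)) (hv : ((2 : ℕ) : 𝓞 K) ∈ v.asIdeal) (hvbar : ((2 : ℕ) : 𝓞 K) ∈ vbar.asIdeal) (hne : vbar ≠ v)
    (π : (W.baseChange K).endRing) (hrel : (π : AddMonoid.End (W.baseChange K).geomPoints) * π = π - 2) {r : ℤ_[2]} (hr : r * r = r - 2)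
    (hpin : ∀ τ ∈ GreenbergSelmer.inertia v, ∀ x : ↥((W.baseChange K).endEigenPrimaryTorsion 2 π r), τ • x = x ∨ τ • x = -x)
    (κ' : ZpExtension K 2) (hκ' : κ'.IsUnramifiedOutside vbar)
    {δ : absoluteGaloisGroup K} (hδD : δ ∈ GreenbergSelmer.decomp vbar) (hδ : κ'.IsTopGenerator δ) :
    Nat.card (endInvariants
      (DistribMulAction.toAddMonoidEnd (absoluteGaloisGroup K) ↥((W.baseChange K).endEigenPrimaryTorsion 2 π r) δ - 1)) = 2 ^ 2 := by
  rw [endInvariants_smul_sub_one_eq_fixedPoints_decomp_vbar_of_frame_classThree hd0 (Or.inl hd8) W C hC hK v vbar hv hvbar hne π hrel hr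
    hpin κ' hκ' hδD hδ]
  exact CMPrimes.natCard_fixedPoints_decomp_vbar_eq_four_of_frame hd0 hd8 W C hC hK v vbar hv hvbar hne π hrel hr hpin

/-- **`hinv` on `d ≡ 14 (mod 16)` (`d = 2d'`, `d' ≡ 7 (8)`): `#W*^{δ} = 2 = 2 ^ 1`** (`δ ∈ D_v̄`, `κ' δ = 1`) — `W*^{δ} = W*^{D_v̄}` and B15's
`CMPrimes.natCard_fixedPoints_decomp_vbar_eq_two_of_frame` (`d ≢ 3 (8)`). [cite: Agboola2007, §6 and Prop. 8.1] [cite: Rubin1999, §3 Cor. 3.17] -/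
theorem natCard_endInvariants_smul_sub_one_eq_two_of_frame_even_seven {d : ℤ} (hd0 : d ≠ 0) (hsq : Squarefree d)
    (h2d : (2 : ℤ) ∣ d) (hd7 : (d / 2) % 8 = 7)
    (W : WeierstrassCurve ℚ) [W.IsElliptic] (C : VariableChange ℚ) (hC : C • W = cm7.quadraticTwist (d : ℚ)) (hK : IsImaginaryQuadratic K)
    (v vbar : HeightOneSpectrum (𝓞 K)) (hv : ((2 : ℕ) : 𝓞 K) ∈ v.asIdeal) (hvbar : ((2 : ℕ) : 𝓞 K) ∈ vbar.asIdeal) (hne : vbar ≠ v)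
    (π : (W.baseChange K).endRing) (hrel : (π : AddMonoid.End (W.baseChange K).geomPoints) * π = π - 2) {r : ℤ_[2]} (hr : r * r = r - 2)
    (hpin : ∀ τ ∈ GreenbergSelmer.inertia v, ∀ x : ↥((W.baseChange K).endEigenPrimaryTorsion 2 π r), τ • x = x ∨ τ • x = -x)
    (κ' : ZpExtension K 2) (hκ' : κ'.IsUnramifiedOutside vbar)
    {δ : absoluteGaloisGroup K} (hδD : δ ∈ GreenbergSelmer.decomp vbar) (hδ : κ'.IsTopGenerator δ) :
    Nat.card (endInvariants
      (DistribMulAction.toAddMonoidEnd (absoluteGaloisGroup K) ↥((W.baseChange K).endEigenPrimaryTorsion 2 π r) δ - 1)) = 2 ^ 1 := by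
  have hd4 : d % 4 ≠ 1 := by obtain ⟨k, rfl⟩ := h2d; omega
  have hd8 : d % 8 ≠ 3 := by obtain ⟨k, rfl⟩ := h2d; omega
  rw [endInvariants_smul_sub_one_eq_fixedPoints_decomp_vbar_of_frame_classThree hd0 (Or.inr ⟨h2d, hd7⟩) W C hC hK v vbar hv hvbar hne π
    hrel hr hpin κ' hκ' hδD hδ]
  exact CMPrimes.natCard_fixedPoints_decomp_vbar_eq_two_of_frame hd0 hsq hd4 hd8 W C hC hK v vbar hv hvbar hne π hrel hr hpin

/-- **`hH` on every road-α member: every infinite subgroup of `W* = ↥((W.baseChange K).endEigenPrimaryTorsion 2 π r)` is `⊤`** (§2 with `j = −3375`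
from the twist of `cm7` and `√−7 ∈ K` from the CM endomorphism `π`). [cite: Rubin1999, §2 and Prop. 5.4] -/
theorem eq_top_of_not_finite_endEigenPrimaryTorsion_of_frame {d : ℤ} (hd0 : d ≠ 0)
    (W : WeierstrassCurve ℚ) [W.IsElliptic] (C : VariableChange ℚ) (hC : C • W = cm7.quadraticTwist (d : ℚ))
    (π : (W.baseChange K).endRing) (hrel : (π : AddMonoid.End (W.baseChange K).geomPoints) * π = π - 2) {r : ℤ_[2]} (hr : r * r = r - 2)
    (A : AddSubgroup ↥((W.baseChange K).endEigenPrimaryTorsion 2 π r)) (hA : ¬ Finite A) : A = ⊤ := by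
  have hj : W.j = -3375 := j_eq_of_smul_eq_cm7Twist hd0 W C hC
  obtain ⟨θ, hθ⟩ := exists_sq_eq_neg_seven_of_cmEndo_mem_endRing W K hj π hrel
  exact eq_top_of_not_finite_endEigenPrimaryTorsion W K hj hθ π hrel hr A hA

/-- On a road-α member, a `δ ∈ Γ_K` whose fixed subgroup `W*^{δ}` is FINITE moves some point of `W*` (`W*` is infinite, B15
`CMPrimes.not_finite_endEigenPrimaryTorsion`). [cite: Rubin1999, §2 and Prop. 5.4] -/
theorem exists_smul_ne_of_finite_endInvariants_of_frame {d : ℤ} (hd0 : d ≠ 0)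
    (W : WeierstrassCurve ℚ) [W.IsElliptic] (C : VariableChange ℚ) (hC : C • W = cm7.quadraticTwist (d : ℚ))
    (π : (W.baseChange K).endRing) (hrel : (π : AddMonoid.End (W.baseChange K).geomPoints) * π = π - 2) {r : ℤ_[2]} (hr : r * r = r - 2)
    {δ : absoluteGaloisGroup K}
    (hfin : Finite (endInvariants
      (DistribMulAction.toAddMonoidEnd (absoluteGaloisGroup K) ↥((W.baseChange K).endEigenPrimaryTorsion 2 π r) δ - 1))) :
    ∃ x : ↥((W.baseChange K).endEigenPrimaryTorsion 2 π r), δ • x ≠ x := by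
  have hj : W.j = -3375 := j_eq_of_smul_eq_cm7Twist hd0 W C hC
  obtain ⟨θ, hθ⟩ := exists_sq_eq_neg_seven_of_cmEndo_mem_endRing W K hj π hrel
  by_contra hall
  push Not at hall
  -- then the invariants are everything, hence `W*` would be finite
  have htop : endInvariants (DistribMulAction.toAddMonoidEnd (absoluteGaloisGroup K)
      ↥((W.baseChange K).endEigenPrimaryTorsion 2 π r) δ - 1) = ⊤ := by
    rw [eq_top_iff]
    intro x _
    exact (mem_endInvariants_smul_sub_one_iff (M := ↥((W.baseChange K).endEigenPrimaryTorsion 2 π r)) δ x).mpr (hall x)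
  rw [htop] at hfin
  exact CMPrimes.not_finite_endEigenPrimaryTorsion W K hj hθ π hrel hr
    (Finite.of_equiv _ (AddSubgroup.topEquiv : (⊤ : AddSubgroup ↥((W.baseChange K).endEigenPrimaryTorsion 2 π r)) ≃+ _).toEquiv)

/-- **`hcoinvH` on `d ≡ 3 (mod 8)`: `W* ⧸ (δ − 1)W* = 0`** for `δ ∈ D_v̄` with `κ' δ = 1` (`W*^{δ}` has `4` elements, so `δ` moves a point; §2).
[cite: GreenbergLNM1716, §3 Lemma 3.1 and p. 87] [cite: Rubin1999, §2 and Prop. 5.4] -/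
theorem subsingleton_endCoinvariants_smul_sub_one_of_frame_three {d : ℤ} (hd0 : d ≠ 0) (hd8 : d % 8 = 3)
    (W : WeierstrassCurve ℚ) [W.IsElliptic] (C : VariableChange ℚ) (hC : C • W = cm7.quadraticTwist (d : ℚ)) (hK : IsImaginaryQuadratic K)
    (v vbar : HeightOneSpectrum (𝓞 K)) (hv : ((2 : ℕ) : 𝓞 K) ∈ v.asIdeal) (hvbar : ((2 : ℕ) : 𝓞 K) ∈ vbar.asIdeal) (hne : vbar ≠ v)
    (π : (W.baseChange K).endRing) (hrel : (π : AddMonoid.End (W.baseChange K).geomPoints) * π = π - 2) {r : ℤ_[2]} (hr : r * r = r - 2)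
    (hpin : ∀ τ ∈ GreenbergSelmer.inertia v, ∀ x : ↥((W.baseChange K).endEigenPrimaryTorsion 2 π r), τ • x = x ∨ τ • x = -x)
    (κ' : ZpExtension K 2) (hκ' : κ'.IsUnramifiedOutside vbar)
    {δ : absoluteGaloisGroup K} (hδD : δ ∈ GreenbergSelmer.decomp vbar) (hδ : κ'.IsTopGenerator δ) :
    Subsingleton (EndCoinvariants
      (DistribMulAction.toAddMonoidEnd (absoluteGaloisGroup K) ↥((W.baseChange K).endEigenPrimaryTorsion 2 π r) δ - 1)) := by
  have hj : W.j = -3375 := j_eq_of_smul_eq_cm7Twist hd0 W C hC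
  obtain ⟨θ, hθ⟩ := exists_sq_eq_neg_seven_of_cmEndo_mem_endRing W K hj π hrel
  refine subsingleton_endCoinvariants_smul_sub_one_of_smul_ne W K hj hθ π hrel hr
    (exists_smul_ne_of_finite_endInvariants_of_frame hd0 W C hC π hrel hr (Nat.finite_of_card_ne_zero ?_))
  rw [natCard_endInvariants_smul_sub_one_eq_four_of_frame_three hd0 hd8 W C hC hK v vbar hv hvbar hne π hrel hr hpin κ' hκ' hδD hδ]
  norm_num

/-- **`hcoinvH` on `d ≡ 14 (mod 16)`: `W* ⧸ (δ − 1)W* = 0`** for `δ ∈ D_v̄` with `κ' δ = 1` (`W*^{δ}` has `2` elements, so `δ` moves a point; §2).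
[cite: GreenbergLNM1716, §3 Lemma 3.1 and p. 87] [cite: Rubin1999, §2 and Prop. 5.4] -/
theorem subsingleton_endCoinvariants_smul_sub_one_of_frame_even_seven {d : ℤ} (hd0 : d ≠ 0) (hsq : Squarefree d)
    (h2d : (2 : ℤ) ∣ d) (hd7 : (d / 2) % 8 = 7)
    (W : WeierstrassCurve ℚ) [W.IsElliptic] (C : VariableChange ℚ) (hC : C • W = cm7.quadraticTwist (d : ℚ)) (hK : IsImaginaryQuadratic K)
    (v vbar : HeightOneSpectrum (𝓞 K)) (hv : ((2 : ℕ) : 𝓞 K) ∈ v.asIdeal) (hvbar : ((2 : ℕ) : 𝓞 K) ∈ vbar.asIdeal) (hne : vbar ≠ v)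
    (π : (W.baseChange K).endRing) (hrel : (π : AddMonoid.End (W.baseChange K).geomPoints) * π = π - 2) {r : ℤ_[2]} (hr : r * r = r - 2)
    (hpin : ∀ τ ∈ GreenbergSelmer.inertia v, ∀ x : ↥((W.baseChange K).endEigenPrimaryTorsion 2 π r), τ • x = x ∨ τ • x = -x)
    (κ' : ZpExtension K 2) (hκ' : κ'.IsUnramifiedOutside vbar)
    {δ : absoluteGaloisGroup K} (hδD : δ ∈ GreenbergSelmer.decomp vbar) (hδ : κ'.IsTopGenerator δ) :
    Subsingleton (EndCoinvariants
      (DistribMulAction.toAddMonoidEnd (absoluteGaloisGroup K) ↥((W.baseChange K).endEigenPrimaryTorsion 2 π r) δ - 1)) := by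
  have hj : W.j = -3375 := j_eq_of_smul_eq_cm7Twist hd0 W C hC
  obtain ⟨θ, hθ⟩ := exists_sq_eq_neg_seven_of_cmEndo_mem_endRing W K hj π hrel
  refine subsingleton_endCoinvariants_smul_sub_one_of_smul_ne W K hj hθ π hrel hr
    (exists_smul_ne_of_finite_endInvariants_of_frame hd0 W C hC π hrel hr (Nat.finite_of_card_ne_zero ?_))
  rw [natCard_endInvariants_smul_sub_one_eq_two_of_frame_even_seven hd0 hsq h2d hd7 W C hC hK v vbar hv hvbar hne π hrel hr hpin κ' hκ'
    hδD hδ]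
  norm_num

end Frame

end Summit.BirchSwinnertonDyer.BirchSwinnertonDyer.Theorems.PrintCf2.StrictDefect

end
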